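import Summits.CriticalPhenomena.PercolationContinuityZ3.Theorems.SahiMasterFamilyCommonPivotal
import Summits.CriticalPhenomena.PercolationContinuityZ3.Theorems.SahiConjectureProduct

/-!
# `NoHeavyLowerTail` (crux stmt-CriticalPhenomena-4575), Sahi programme P2 (gen 16): THE SLICE MINIMUM PRINCIPLE
# — a one-coordinate statement that implies Sahi's `C_n` on product measures (Kahn's Conjecture 5 at `n = 3`) by
# induction on the number of coins

Support file (`--supports stmt-CriticalPhenomena-4575`, cell `prim-masterthm`, seat P2, generation 16).  Nothing here
asserts Kahn's or Sahi's conjecture; the principle below is TYPED as an obligation (`@[conjecture]`) and the file proves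
the REDUCTION, for every order `n`.

THE PRINCIPLE (new; not in print).  For a product measure `μ_p` on `2^ι` and `n` increasing events `U₀,…,U_{n−1}`,
write `G(p) = E_n(μ_p; 1_{U₀},…,1_{U_{n−1}})` (Sahi's functional, tree `sahiE (bernoulliWeight p) n`).  Freezing one
coin `e` at `b ∈ {0,1}` (the product measure `μ_{p[e ↦ b]}`, i.e. `E_n` of the `e`-SECTIONS `U_j|_{x_e=b}` under the
product measure on the remaining coins) gives the `2|ι|` FACET VALUES `G(p[e ↦ b])`.  **Slice minimum principle of order
`n`** (`SliceMinimumPrinciple n`): if some coin is live (bias in `(0,1)`) then for SOME live coin `e` and SOME `b ∈ {0,1}`,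
`G(p[e ↦ b]) ≤ G(p)` — "`E_n` is at least the smallest of its coordinate-hyperplane slices"; equivalently, one can always
KILL A COIN (replace every member by its outer, or every member by its inner, `e`-cylinder hull) without increasing `E_n`.

THE REDUCTION (proved here, every `n`).  `SliceMinimumPrinciple n → MasterFamilyNonneg n`
(`masterFamilyNonneg_of_sliceMinimumPrinciple`; induction on the number of live coins — when every coin is frozen, `μ_p`
is a point mass and `E_n = 0` for `n ≥ 2`, `sahiE_eq_zero_of_frozen`, by the Lieb–Sahi recursion); hence at `n = 3`
`→ KahnConjecture` and `→ SahiConjecture 3`, and for all orders `(∀ n, SliceMinimumPrinciple n) → ∀ n, SahiConjecture n`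
(Sahi's `C_n` for EVERY FKG measure on EVERY finite distributive lattice, via the tree's `masterFamilyNonneg_iff_sahiPositive`
and `sahiConjecture_iff_forall_bernoulliWeight`).  For `n = 2` the principle is a THEOREM, at EVERY live coin
(`sliceMinimumPrinciple_two`: the fibre `s ↦ Cov_{p[e↦s]}(A,B)` is a concave quadratic — its chord defect is
`s(1−s)·I_e(A)·I_e(B) ≥ 0`, `sahiE_two_update_sub_chord` — so it is at least its smaller endpoint value; with the
reduction this is Harris' inequality by induction on coins).

WHY IT IS WORTH TYPING (evidence for `n = 3`; exact rational arithmetic unless marked; this seat, code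
`prim-masterthm-p2/code/gen16/`): ZERO failures on: all triples of up-sets of `{0,1}³` × 200 product measures and of
`{0,1}⁴` × 40 (3.2·10⁷ triples), `{0,1}⁵` uniform (2.1·10⁸ sampled; exhaustive × 12 measures = kit j150174), the structured
`k = 5,6` families that killed every earlier ∃-criterion of this lane (doubled star-α, augmented block star, `K₄` matchings,
the (T3)-killer, the DT-AVG witness, the K = 4 sum-form witness) × ~40 measures each, sparse corners `p_e ∈ {10⁻², 10⁻³, ½, …}`
(`k = 4,5,6`), adversarial/annealed searches `k = 4..7` (~10⁴ triples with `p` optimised against it; long double); orders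
`n = 4, 5` on `{0,1}³`, `{0,1}⁴` (6·10³ exact tests); and the CHAIN-GRID analogue ("`E₃` of three down-sets of a product of
chains ≥ the least `E₃` among its coordinate-layer slices, indeed among the 2r EXTREME layers") on `[a]×[b]` (`a,b ≤ 8`, 10⁸
weighted triples) and `[2..3]×[2..4]×[2..5]` (10⁹).  It is STRICTLY WEAKER than the refuted chord criterion (B∃) of gen 14
(chord ≥ min of endpoints), and every refuting family of (B∃)/FBP has a facet value `0` (independent tops), so it passes there
with room `E₃` itself.  Per-coordinate versions are FALSE (a single axis can dip), as are the averaged (AVG, "agreement-tilted")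
and local-concavity (`Σ p_e(1−p_e)∂²_eG ≤ 0`) strengthenings — the choice of the coordinate is essential.
HONEST LABEL: a conjecture with a kernel-checked reduction; `C_n`, `n ≥ 3`, remains OPEN.
-/

noncomputable section

open scoped Classical

namespace Summit.CriticalPhenomena.PercolationContinuityZ3.Theorems

open Finset Function
open Literature.Combinatorics.Sahi2008
open Literature.Probability.Percolation.DecisionTree (ind ind_of_mem ind_of_not_mem ind_nonneg)

namespace SahiSliceMinimum

/-! ### Live and frozen coins -/

/-- The set of **live** coins of `p`: those with bias strictly between `0` and `1` (the others are frozen at `0` or `1`).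
[this work] -/
def liveSet {ι : Type*} [Fintype ι] (p : ι → unitInterval) : Finset ι :=
  Finset.univ.filter fun e => 0 < (p e : ℝ) ∧ (p e : ℝ) < 1

variable {ι : Type*}

/-- Membership in `liveSet`. [this work] -/
theorem mem_liveSet [Fintype ι] (p : ι → unitInterval) (e : ι) :
    e ∈ liveSet p ↔ 0 < (p e : ℝ) ∧ (p e : ℝ) < 1 := by
  unfold liveSet
  rw [Finset.mem_filter]
  exact ⟨fun h => h.2, fun h => ⟨Finset.mem_univ e, h⟩⟩

/-- A coin that is not live is frozen at `0` or at `1`. [folklore] -/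
theorem eq_zero_or_eq_one_of_not_live (p : ι → unitInterval) (e : ι) (h : ¬ (0 < (p e : ℝ) ∧ (p e : ℝ) < 1)) :
    (p e : ℝ) = 0 ∨ (p e : ℝ) = 1 := by
  rcases (p e).2 with ⟨h0, h1⟩
  by_cases hz : (p e : ℝ) = 0
  · exact Or.inl hz
  · by_cases ho : (p e : ℝ) = 1
    · exact Or.inr ho
    · exact absurd ⟨lt_of_le_of_ne h0 (Ne.symm hz), lt_of_le_of_ne h1 ho⟩ h

variable [Fintype ι]

/-! ### Frozen coins: when every `p_e ∈ {0,1}` the product weight is a point mass and `E_n = 0` (`n ≥ 2`) -/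

/-- **All coins frozen ⇒ the product weight is the point mass at `ω₀ = {e | p_e = 1}`.** [folklore] -/
theorem bernoulliWeight_of_frozen (p : ι → unitInterval) (hp : ∀ e, (p e : ℝ) = 0 ∨ (p e : ℝ) = 1) (ω : Set ι) :
    bernoulliWeight p ω = if ω = {e | (p e : ℝ) = 1} then 1 else 0 := by
  classical
  show Literature.Probability.Percolation.BHK2006.weight _ ω = _
  unfold Literature.Probability.Percolation.BHK2006.weight
  dsimp only
  split_ifs with hω
  · refine Finset.prod_eq_one fun e _ => ?_
    by_cases he : e ∈ ω
    · rw [if_pos he]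
      have : e ∈ ({e | (p e : ℝ) = 1} : Set ι) := hω ▸ he
      exact this
    · rw [if_neg he]
      have hne : (p e : ℝ) ≠ 1 := fun h1 => he (hω ▸ (show e ∈ ({e | (p e : ℝ) = 1} : Set ι) from h1))
      rcases hp e with h0 | h1
      · rw [h0]; norm_num
      · exact absurd h1 hne
  · -- some coordinate distinguishes `ω` from `ω₀`; its factor vanishes
    have hex : ∃ e, ¬ (e ∈ ω ↔ e ∈ ({e | (p e : ℝ) = 1} : Set ι)) := by
      by_contra hall
      apply hω
      ext e
      by_contra hne
      exact hall ⟨e, hne⟩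
    obtain ⟨e, he⟩ := hex
    refine Finset.prod_eq_zero (Finset.mem_univ e) ?_
    by_cases hmem : e ∈ ω
    · rw [if_pos hmem]
      have h1 : ¬ (p e : ℝ) = 1 := fun h => he ⟨fun _ => h, fun _ => hmem⟩
      rcases hp e with h0 | h1'
      · exact h0
      · exact absurd h1' h1
    · rw [if_neg hmem]
      have h1 : (p e : ℝ) = 1 := by
        by_contra h
        exact he ⟨fun hm => absurd hm hmem, fun hm => absurd hm h⟩
      rw [h1]; norm_num

/-- Expectation under a point mass is evaluation. [folklore] -/
theorem ex_of_frozen (p : ι → unitInterval) (hp : ∀ e, (p e : ℝ) = 0 ∨ (p e : ℝ) = 1) (f : Set ι → ℝ) :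
    ex (bernoulliWeight p) f = f {e | (p e : ℝ) = 1} := by
  classical
  rw [ex_def]
  simp_rw [bernoulliWeight_of_frozen p hp]
  simp [Finset.sum_ite_eq']

/-- **All coins frozen ⇒ `E_{n+2} = 0`** for every family of functions: under a point mass every `E_m`, `m ≥ 2`,
vanishes (induction along the Lieb–Sahi recursion; `E₂ = fg − f·g = 0` at a point). [this work] -/
theorem sahiE_eq_zero_of_frozen (p : ι → unitInterval) (hp : ∀ e, (p e : ℝ) = 0 ∨ (p e : ℝ) = 1) :
    ∀ (n : ℕ) (F : Fin (n + 2) → Set ι → ℝ), sahiE (bernoulliWeight p) (n + 2) F = 0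
  | 0, F => by
    rw [sahiE_two_apply]
    simp only [ex_of_frozen p hp, Pi.mul_apply]
    ring
  | n + 1, F => by
    rw [sahiE_succ_succ]
    rw [Finset.sum_eq_zero fun i _ => sahiE_eq_zero_of_frozen p hp n _, sahiE_eq_zero_of_frozen p hp n _]
    ring

/-! ### The principle (typed) -/

/-- **THE SLICE MINIMUM PRINCIPLE of order `n`** (conjecture of this seat, census-clean for `n = 3,4,5`; a THEOREM for
`n = 2` — concavity of the covariance fibre; see the file header): for every finite `ι`, every `p : ι → [0,1]` with at
least one live coin and every `n` increasing events `U_j ⊆ 2^ι`, there are a LIVE coin `e` and a value `b ∈ {0,1}` such that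
freezing `e` at `b` does not increase Sahi's `E_n`: `E_n(μ_{p[e↦b]}; 1_U) ≤ E_n(μ_p; 1_U)`.  (`E_n` under `μ_{p[e↦b]}` is
`E_n` of the `e`-sections at `x_e = b` under the product measure on the other coins: "`E_n` dominates its smallest
coordinate slice".)  An obligation / hypothesis; never import it as a fact.  [this work] [status: open for n ≥ 3; conjecture] -/
@[conjecture] def SliceMinimumPrinciple (n : ℕ) : Prop :=
  ∀ (ι : Type) [Fintype ι] (p : ι → unitInterval) (U : Fin n → Set (Set ι)),
    (∀ j, IsUpperSet (U j)) → (liveSet p).Nonempty →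
      ∃ e ∈ liveSet p, ∃ b : unitInterval, ((b : ℝ) = 0 ∨ (b : ℝ) = 1) ∧
        sahiE (bernoulliWeight (Function.update p e b)) n (fun j => ind (U j)) ≤
          sahiE (bernoulliWeight p) n (fun j => ind (U j))

/-! ### Order 2 is a theorem: the covariance fibre is concave along every coin -/

/-- Section moments of the indicator of an increasing event are monotone in the frozen value:
`X₀(1_A) ≤ X₁(1_A)` (`secEx` of `…SahiMasterFamilyCommonPivotal`). [folklore] -/
theorem secEx_ind_mono (p : ι → unitInterval) (e : ι) {A : Set (Set ι)} (hA : IsUpperSet A) :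
    secEx p e (ind A) false ≤ secEx p e (ind A) true := by
  unfold secEx
  refine Finset.sum_le_sum fun ω _ => mul_le_mul_of_nonneg_left ?_ (offWeight_nonneg p e ω)
  simp only [Bool.false_eq_true, if_false, if_true]
  by_cases h : ω ∈ A
  · rw [ind_of_mem h, ind_of_mem (hA (Set.subset_insert e ω) h)]
  · rw [ind_of_not_mem h]; exact ind_nonneg A _

/-- **`E₂` along one coin is a CONCAVE quadratic**: with `q_s = p[e ↦ s]`,
`E₂(μ_{q_s};f,g) − [(1−s)E₂(μ_{q_0}) + sE₂(μ_{q_1})] = s(1−s)·(X₁f − X₀f)(X₁g − X₀g)`. [this work] -/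
theorem sahiE_two_update_sub_chord (p : ι → unitInterval) (e : ι) (s : unitInterval) (f g : Set ι → ℝ) :
    sahiE (bernoulliWeight (update p e s)) 2 ![f, g] -
        ((1 - (s : ℝ)) * sahiE (bernoulliWeight (update p e 0)) 2 ![f, g] +
          (s : ℝ) * sahiE (bernoulliWeight (update p e 1)) 2 ![f, g]) =
      (s : ℝ) * (1 - (s : ℝ)) *
        ((secEx p e f true - secEx p e f false) * (secEx p e g true - secEx p e g false)) := by
  simp only [sahiE_two, ex_update_eq, Set.Icc.coe_zero, Set.Icc.coe_one]
  ring

/-- **THE SLICE MINIMUM PRINCIPLE HOLDS AT ORDER 2, at every live coin** (hence Harris' inequality by induction on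
coins): for increasing `A, B` the fibre `s ↦ Cov_{p[e↦s]}(A,B)` is concave (its chord defect is
`s(1−s)·I_e(A)I_e(B) ≥ 0`), so it is at least the smaller endpoint value. [this work] -/
theorem sliceMinimumPrinciple_two : SliceMinimumPrinciple 2 := by
  intro ι _ p U hU hlive
  obtain ⟨e, he⟩ := hlive
  refine ⟨e, he, ?_⟩
  have hF : (fun j => ind (U j)) = ![ind (U 0), ind (U 1)] := by
    funext j; fin_cases j <;> rfl
  rw [hF]
  set s : unitInterval := p e with hs
  have hp : p = update p e s := by rw [hs, update_eq_self]
  have hR : sahiE (bernoulliWeight (update p e s)) 2 ![ind (U 0), ind (U 1)] =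
      sahiE (bernoulliWeight p) 2 ![ind (U 0), ind (U 1)] := by rw [← hp]
  have key := sahiE_two_update_sub_chord p e s (ind (U 0)) (ind (U 1))
  have hI : 0 ≤ (secEx p e (ind (U 0)) true - secEx p e (ind (U 0)) false) *
      (secEx p e (ind (U 1)) true - secEx p e (ind (U 1)) false) :=
    mul_nonneg (sub_nonneg.2 (secEx_ind_mono p e (hU 0))) (sub_nonneg.2 (secEx_ind_mono p e (hU 1)))
  have hs0 : 0 ≤ (s : ℝ) := s.2.1
  have hs1 : (s : ℝ) ≤ 1 := s.2.2
  have hconc : (1 - (s : ℝ)) * sahiE (bernoulliWeight (update p e 0)) 2 ![ind (U 0), ind (U 1)] +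
      (s : ℝ) * sahiE (bernoulliWeight (update p e 1)) 2 ![ind (U 0), ind (U 1)] ≤
      sahiE (bernoulliWeight (update p e s)) 2 ![ind (U 0), ind (U 1)] := by
    have : 0 ≤ (s : ℝ) * (1 - (s : ℝ)) *
        ((secEx p e (ind (U 0)) true - secEx p e (ind (U 0)) false) *
          (secEx p e (ind (U 1)) true - secEx p e (ind (U 1)) false)) :=
      mul_nonneg (mul_nonneg hs0 (sub_nonneg.2 hs1)) hI
    linarith
  by_cases hmin : sahiE (bernoulliWeight (update p e 0)) 2 ![ind (U 0), ind (U 1)] ≤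
      sahiE (bernoulliWeight (update p e 1)) 2 ![ind (U 0), ind (U 1)]
  · refine ⟨0, Or.inl Set.Icc.coe_zero, ?_⟩
    rw [← hR]
    nlinarith
  · refine ⟨1, Or.inr Set.Icc.coe_one, ?_⟩
    rw [← hR]
    have hmin' : sahiE (bernoulliWeight (update p e 1)) 2 ![ind (U 0), ind (U 1)] ≤
        sahiE (bernoulliWeight (update p e 0)) 2 ![ind (U 0), ind (U 1)] := le_of_not_ge hmin
    nlinarith

/-! ### The reduction: the principle implies the master family inequality, Kahn's Conjecture 5 and Sahi's `C_n` -/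

/-- Freezing a live coin lowers the number of live coins. [folklore] -/
theorem card_liveSet_update_lt (p : ι → unitInterval) {e : ι} (he : e ∈ liveSet p)
    (b : unitInterval) (hb : (b : ℝ) = 0 ∨ (b : ℝ) = 1) :
    (liveSet (Function.update p e b)).card < (liveSet p).card := by
  apply Finset.card_lt_card
  refine ⟨fun i hi => ?_, fun hsub => ?_⟩
  · rw [mem_liveSet] at hi ⊢
    by_cases hie : i = e
    · subst hie
      exact (mem_liveSet p i).1 he
    · rwa [Function.update_of_ne hie b p] at hi
  · have hl := (mem_liveSet _ e).1 (hsub he)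
    rw [Function.update_self] at hl
    rcases hb with h0 | h1
    · rw [h0] at hl; exact lt_irrefl _ hl.1
    · rw [h1] at hl; exact lt_irrefl _ hl.2

/-- **The slice minimum principle of order `n` implies the master family inequality of order `n`** (`E_n ≥ 0` for `n`
increasing events under every product measure): induction on the number of live coins — freeze a coin given by the
principle without increasing `E_n`; with no live coin `E_n = 0` (orders `n ≤ 1` hold outright). [this work] -/
theorem masterFamilyNonneg_of_sliceMinimumPrinciple {n : ℕ} (h : SliceMinimumPrinciple n) : MasterFamilyNonneg n := by
  match n with
  | 0 => exact masterFamilyNonneg_of_le_two (by omega)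
  | 1 => exact masterFamilyNonneg_of_le_two (by omega)
  | m + 2 =>
    intro ι _ p U hU
    suffices H : ∀ (c : ℕ) (q : ι → unitInterval), (liveSet q).card = c →
        0 ≤ sahiE (bernoulliWeight q) (m + 2) (fun j => ind (U j)) from H _ p rfl
    intro c
    induction c using Nat.strong_induction_on with
    | _ c ih =>
      intro q hq
      by_cases hlive : (liveSet q).Nonempty
      · obtain ⟨e, he, b, hb, hle⟩ := h ι q U hU hlive
        have hlt := card_liveSet_update_lt q he b hb
        rw [hq] at hlt
        exact le_trans (ih _ hlt (Function.update q e b) rfl) hle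
      · have hfrozen : ∀ e, (q e : ℝ) = 0 ∨ (q e : ℝ) = 1 := fun e =>
          eq_zero_or_eq_one_of_not_live q e fun hl => hlive ⟨e, (mem_liveSet q e).2 hl⟩
        rw [sahiE_eq_zero_of_frozen q hfrozen m]

/-- **Order 3: the slice minimum principle implies Kahn's Conjecture 5** (`C₃` for every product measure). [this work] -/
theorem kahnConjecture_of_sliceMinimumPrinciple (h : SliceMinimumPrinciple 3) : KahnConjecture :=
  masterFamilyNonneg_three_iff_kahnConjecture.1 (masterFamilyNonneg_of_sliceMinimumPrinciple h)

/-- **Order 3: the slice minimum principle implies Sahi's `C₃` in full** (every FKG probability weight on every finite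
distributive lattice is Sahi-positive of order 3), via the tree's `SahiConjecture 3 ↔ KahnConjecture`. [this work] -/
theorem sahiConjecture_three_of_sliceMinimumPrinciple (h : SliceMinimumPrinciple 3) : SahiConjecture 3 :=
  sahiConjecture_three_iff_kahnConjecture.2 (kahnConjecture_of_sliceMinimumPrinciple h)

/-- **Every order: the slice minimum principle of order `n` implies Sahi's `C_n`** (all FKG measures, all finite
distributive lattices), via the layer cake (`masterFamilyNonneg_iff_sahiPositive`) and the tree's reduction of `C_n` to
product weights (`sahiConjecture_iff_forall_bernoulliWeight`). [this work] -/
theorem sahiConjecture_of_sliceMinimumPrinciple {n : ℕ} (h : SliceMinimumPrinciple n) : SahiConjecture n :=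
  (sahiConjecture_iff_forall_bernoulliWeight n).2
    ((masterFamilyNonneg_iff_sahiPositive n).1 (masterFamilyNonneg_of_sliceMinimumPrinciple h))

/-- **All orders at once**: the slice minimum principles imply the whole Sahi hierarchy `∀ n, C_n`. [this work] -/
theorem forall_sahiConjecture_of_forall_sliceMinimumPrinciple (h : ∀ n, SliceMinimumPrinciple n) :
    ∀ n, SahiConjecture n :=
  fun n => sahiConjecture_of_sliceMinimumPrinciple (h n)

end SahiSliceMinimum

end Summit.CriticalPhenomena.PercolationContinuityZ3.Theorems
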